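import Literature.Probability.LatticeModels.DiscreteGFFInnovation
import HarnessLib

/-!
# Gaussian lattice fields with the innovation property at a site: flip and shift identities

Topic `Literature/Probability/LatticeModels`; continuation of `DiscreteGFFInnovation.lean` (the
configuration-level maps `siteInnovation`, `siteFlip`, `rebuildAt`, `restrictOff` and the
one-dimensional Gaussian changes of variables). For a real Gaussian lattice field
`X = (X_x)_{x ∈ ℤ^d}` on `(Ω, P)` with measurable, centred coordinates and the **innovation
property at `u`** — `E[ζ_u X_w] = δ_{uw}/2d` for `ζ_u = X_u - (2d)⁻¹ ∑_{v ∼ u} X_v`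
(`IsInnovationSite`) — we prove:

* `IsInnovationSite.indepFun_innovation_restrictOff` — `ζ_u ⊥ (X_w)_{w ≠ u}` (Mathlib:
  jointly Gaussian + uncorrelated ⇒ independent), `IsInnovationSite.map_innovation_eq` —
  `ζ_u ∼ N(0, 1/2d)`, and the disintegration `IsInnovationSite.lintegral_eq`:
  `E F(X) = ∫ (∫ F(rebuildAt u z y) N(0,1/2d)(dz)) Q(dy)`, `Q` the law of `(X_w)_{w ≠ u}`;
* **`IsInnovationSite.lintegral_comp_siteFlip`**: `E F(R_u X) = E[F(X) exp(-2 X_u ∑_{v∼u} X_v)]` —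
  the one-site case of the change of variables behind Lupu 2016, Lemma 4.1 / Prop. 4.2 (flipping
  the sign of the free field on a set `S` costs the factor `exp(-2 ∑_{x∈S, y∉S, x∼y} ψ_x ψ_y)`,
  the cross terms of the energy `H`), here derived without densities;
* **`IsInnovationSite.lintegral_comp_add_single`** (Cameron–Martin at one site):
  `E F(X + t e_u) = E[F(X) exp(2dt ζ_u - d t²)]`.

References: T. Lupu, Ann. Probab. 44 (2016), §4, Lemma 4.1 and Prop. 4.2 [`Lupu2016`]; the
innovation/Markov structure is classical, tagged `[folklore]`.
-/

noncomputable section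

namespace Literature.Probability.LatticeModels

open _root_.MeasureTheory _root_.ProbabilityTheory Finset
open scoped ENNReal NNReal

variable {d : ℕ} {Ω : Type*} [MeasurableSpace Ω]

/-! ### The hypothesis and the pair process -/

/-- The variance `1/2d` of a single-site innovation, as an `ℝ≥0`. [folklore] -/
def innovVar (d : ℕ) : ℝ≥0 := ⟨(2 * d : ℝ)⁻¹, by positivity⟩

/-- `innovVar d = 1/2d` as a real number. [folklore] -/
@[simp] theorem coe_innovVar (d : ℕ) : (innovVar d : ℝ) = (2 * d : ℝ)⁻¹ := rfl

/-- `innovVar d ≠ 0` for `d ≥ 1`. [folklore] -/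
theorem innovVar_ne_zero (hd : 0 < d) : innovVar d ≠ 0 := by
  intro h
  have h' : ((innovVar d : ℝ≥0) : ℝ) = 0 := by rw [h]; rfl
  rw [coe_innovVar] at h'
  have : (0 : ℝ) < (2 * d : ℝ)⁻¹ := by positivity
  linarith

/-- **A centred Gaussian lattice field with the innovation property at `u`**: `X` is a Gaussian
process with measurable centred coordinates, and the innovation
`ζ_u = X_u - (2d)⁻¹ ∑_{v ∼ u} X_v` satisfies `E[ζ_u X_w] = δ_{uw} / 2d` for every `w`. (For the
free field of `ℤ^d`, `E[X_x X_y] = G(x - y)` with `-Δ G = δ`, this holds at every `u`; for the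
Dirichlet field of a finite `Λ` it holds at every `u ∈ Λ`.) [folklore] -/
structure IsInnovationSite (P : Measure Ω) (X : Site d → Ω → ℝ) (u : Site d) : Prop where
  /-- all finite-dimensional marginals are Gaussian -/
  isGaussianProcess : IsGaussianProcess X P
  /-- the coordinates are measurable -/
  measurable : ∀ x, Measurable (X x)
  /-- the field is centred -/
  integral_eq_zero : ∀ x, ∫ ω, X x ω ∂P = 0
  /-- the innovation property at `u` -/
  integral_innovation_mul : ∀ w, ∫ ω, siteInnovation (X · ω) u * X w ω ∂P =
    if w = u then (2 * d : ℝ)⁻¹ else 0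

/-- The **pair process** `(ζ_u, (X_w)_{w ≠ u})` indexed by `Unit ⊕ {w // w ≠ u}`. [folklore] -/
def pairProcess (X : Site d → Ω → ℝ) (u : Site d) : Unit ⊕ {w : Site d // w ≠ u} → Ω → ℝ :=
  Sum.elim (fun _ ω => siteInnovation (X · ω) u) (fun w => X w)

namespace IsInnovationSite

variable {P : Measure Ω} {X : Site d → Ω → ℝ} {u : Site d}

/-- The configuration-valued map `ω ↦ X(ω)` is measurable. [folklore] -/
theorem measurable_field (h : IsInnovationSite P X u) : Measurable fun ω => (X · ω) :=
  measurable_pi_lambda _ h.measurable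

/-- The innovation `ζ_u` is measurable. [folklore] -/
theorem measurable_innovation (h : IsInnovationSite P X u) :
    Measurable fun ω => siteInnovation (X · ω) u :=
  (measurable_siteInnovation u).comp h.measurable_field

/-- The restricted field `(X_w)_{w ≠ u}` is measurable. [folklore] -/
theorem measurable_restrict (h : IsInnovationSite P X u) :
    Measurable fun ω => restrictOff u (X · ω) :=
  (measurable_restrictOff u).comp h.measurable_field

/-- The pair process is Gaussian (each coordinate is a finite linear combination of coordinates
of `X`). [folklore] -/
theorem isGaussianProcess_pairProcess (h : IsInnovationSite P X u) :
    IsGaussianProcess (pairProcess X u) P := by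
  classical
  refine h.isGaussianProcess.of_isGaussianProcess fun s => ?_
  rcases s with ⟨⟩ | ⟨w, hw⟩
  · -- the innovation: coordinates in `insert u (neighbours of u)`
    set I : Finset (Site d) := insert u ((zdGraph d).neighborFinset u) with hI
    refine ⟨I, ContinuousLinearMap.proj (R := ℝ) (⟨u, Finset.mem_insert_self _ _⟩ : I) -
      (2 * d : ℝ)⁻¹ • ∑ v ∈ ((zdGraph d).neighborFinset u).attach,
        ContinuousLinearMap.proj (R := ℝ) (⟨v.1, Finset.mem_insert_of_mem v.2⟩ : I), fun ω => ?_⟩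
    simp only [pairProcess, Sum.elim_inl, siteInnovation, zdNeighborSum, FunLike.coe_sub,
      FunLike.coe_smul, FunLike.coe_sum, Pi.sub_apply, Pi.smul_apply,
      Finset.sum_apply, ContinuousLinearMap.proj_apply, Finset.restrict_def, smul_eq_mul]
    congr 1
    rw [← Finset.sum_attach ((zdGraph d).neighborFinset u)]
  · refine ⟨{w}, ContinuousLinearMap.proj (R := ℝ) (⟨w, Finset.mem_singleton_self w⟩ : ({w} : Finset _)),
      fun ω => ?_⟩
    simp [pairProcess]

/-- The innovation `ζ_u` has a Gaussian law. [folklore] -/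
theorem hasGaussianLaw_innovation (h : IsInnovationSite P X u) :
    HasGaussianLaw (fun ω => siteInnovation (X · ω) u) P :=
  h.isGaussianProcess_pairProcess.hasGaussianLaw_eval (Sum.inl ())

/-- The underlying measure is a probability measure. [folklore] -/
theorem isProbabilityMeasure (h : IsInnovationSite P X u) : IsProbabilityMeasure P :=
  h.isGaussianProcess.isProbabilityMeasure

/-- `E[ζ_u] = 0`. [folklore] -/
theorem integral_innovation (h : IsInnovationSite P X u) :
    ∫ ω, siteInnovation (X · ω) u ∂P = 0 := by
  have hint : ∀ x, Integrable (X x) P := fun x =>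
    (h.isGaussianProcess.hasGaussianLaw_eval x).integrable
  simp only [siteInnovation, zdNeighborSum]
  rw [integral_sub (hint u) ((integrable_finsetSum _ fun v _ => hint v).const_mul _),
    integral_const_mul, integral_finsetSum _ fun v _ => hint v]
  simp [h.integral_eq_zero]

/-- `E[ζ_u²] = 1/2d`. [folklore] -/
theorem integral_innovation_sq (h : IsInnovationSite P X u) :
    ∫ ω, siteInnovation (X · ω) u ^ 2 ∂P = (2 * d : ℝ)⁻¹ := by
  have h2 : ∀ x, MemLp (X x) 2 P := fun x => (h.isGaussianProcess.hasGaussianLaw_eval x).memLp_two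
  have hζ2 : MemLp (fun ω => siteInnovation (X · ω) u) 2 P := h.hasGaussianLaw_innovation.memLp_two
  have hprod : ∀ x, Integrable (fun ω => siteInnovation (X · ω) u * X x ω) P := fun x =>
    hζ2.integrable_mul (h2 x)
  have hexp : ∀ ω, siteInnovation (X · ω) u ^ 2 = siteInnovation (X · ω) u * X u ω -
      (2 * d : ℝ)⁻¹ * ∑ v ∈ (zdGraph d).neighborFinset u, siteInnovation (X · ω) u * X v ω := by
    intro ω
    rw [← Finset.mul_sum, mul_left_comm, ← mul_sub, sq]
    rfl
  simp_rw [hexp]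
  rw [integral_sub (hprod u) ((integrable_finsetSum _ fun v _ => hprod v).const_mul _),
    integral_const_mul, integral_finsetSum _ fun v _ => hprod v, h.integral_innovation_mul u,
    if_pos rfl]
  have hzero : ∑ v ∈ (zdGraph d).neighborFinset u, ∫ ω, siteInnovation (X · ω) u * X v ω ∂P = 0 := by
    refine Finset.sum_eq_zero fun v hv => ?_
    rw [h.integral_innovation_mul v, if_neg]
    rw [SimpleGraph.mem_neighborFinset] at hv
    exact fun hvu => (hvu ▸ hv).ne rfl
  rw [hzero, mul_zero, sub_zero]

/-- **`ζ_u ∼ N(0, 1/2d)`.** [folklore] -/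
theorem map_innovation_eq (h : IsInnovationSite P X u) :
    P.map (fun ω => siteInnovation (X · ω) u) = gaussianReal 0 (innovVar d) := by
  have := h.isProbabilityMeasure
  rw [h.hasGaussianLaw_innovation.map_eq_gaussianReal, h.integral_innovation,
    variance_of_integral_eq_zero h.measurable_innovation.aemeasurable h.integral_innovation]
  congr 1
  apply NNReal.eq
  rw [coe_innovVar, Real.coe_toNNReal _ (by positivity)]
  exact h.integral_innovation_sq

/-- **`ζ_u` is independent of `(X_w)_{w ≠ u}`** (jointly Gaussian, uncorrelated). [folklore] -/
theorem indepFun_innovation_restrictOff (h : IsInnovationSite P X u) :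
    IndepFun (fun ω => siteInnovation (X · ω) u) (fun ω => restrictOff u (X · ω)) P := by
  have := h.isProbabilityMeasure
  have hζ2 : MemLp (fun ω => siteInnovation (X · ω) u) 2 P := h.hasGaussianLaw_innovation.memLp_two
  have h2 : ∀ x, MemLp (X x) 2 P := fun x => (h.isGaussianProcess.hasGaussianLaw_eval x).memLp_two
  have hpair : IndepFun (fun ω (_ : Unit) => siteInnovation (X · ω) u)
      (fun ω (w : {w : Site d // w ≠ u}) => X w ω) P := by
    refine IsGaussianProcess.indepFun_of_covariance_eq_zero (X := fun _ : Unit => fun ω =>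
      siteInnovation (X · ω) u) (Y := fun w : {w : Site d // w ≠ u} => X w)
      h.isGaussianProcess_pairProcess (fun _ => h.measurable_innovation.aemeasurable)
      (fun w => (h.measurable w).aemeasurable) fun _ w => ?_
    rw [covariance_eq_sub hζ2 (h2 w), h.integral_innovation, zero_mul, sub_zero]
    change ∫ ω, siteInnovation (X · ω) u * X w ω ∂P = 0
    rw [h.integral_innovation_mul w, if_neg w.2]
  exact hpair.comp (φ := fun f : Unit → ℝ => f ()) (ψ := id) (measurable_pi_apply ()) measurable_id

/-- **Disintegration along the innovation at `u`**: for measurable `F ≥ 0`,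
`E F(X) = ∫ (∫ F(rebuildAt u z y) N(0,1/2d)(dz)) Q(dy)`, `Q` the law of `(X_w)_{w ≠ u}`. [folklore] -/
theorem lintegral_eq (h : IsInnovationSite P X u) {F : (Site d → ℝ) → ℝ≥0∞} (hF : Measurable F) :
    ∫⁻ ω, F (X · ω) ∂P =
      ∫⁻ y, ∫⁻ z, F (rebuildAt u z y) ∂gaussianReal 0 (innovVar d)
        ∂P.map (fun ω => restrictOff u (X · ω)) := by
  have := h.isProbabilityMeasure
  have hFr : Measurable fun p : ℝ × ({w : Site d // w ≠ u} → ℝ) => F (rebuildAt u p.1 p.2) :=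
    hF.comp (measurable_rebuildAt u)
  calc ∫⁻ ω, F (X · ω) ∂P
      = ∫⁻ ω, F (rebuildAt u (siteInnovation (X · ω) u) (restrictOff u (X · ω))) ∂P := by
        simp_rw [rebuildAt_siteInnovation_restrictOff]
    _ = ∫⁻ p, F (rebuildAt u p.1 p.2)
          ∂P.map (fun ω => (siteInnovation (X · ω) u, restrictOff u (X · ω))) :=
        (lintegral_map hFr (h.measurable_innovation.prodMk h.measurable_restrict)).symm
    _ = ∫⁻ p, F (rebuildAt u p.1 p.2) ∂(P.map fun ω => siteInnovation (X · ω) u).prod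
          (P.map fun ω => restrictOff u (X · ω)) := by
        rw [(indepFun_iff_map_prod_eq_prod_map_map h.measurable_innovation.aemeasurable
          h.measurable_restrict.aemeasurable).1 h.indepFun_innovation_restrictOff]
    _ = ∫⁻ y, ∫⁻ z, F (rebuildAt u z y) ∂(P.map fun ω => siteInnovation (X · ω) u)
          ∂P.map (fun ω => restrictOff u (X · ω)) := lintegral_prod_symm _ hFr.aemeasurable
    _ = _ := by rw [h.map_innovation_eq]

/-- **The one-site sign flip** (`d ≥ 1`): for measurable `F ≥ 0`,
`E F(R_u X) = E[F(X) · exp(-2 X_u ∑_{v ∼ u} X_v)]`. In the innovation coordinate the flip is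
`z ↦ -z - 2m` (`siteFlip_rebuildAt`), a reflection followed by a translation of `N(0,1/2d)`, whose
density ratio is the displayed exponential. (One-site case of the factor
`∏ e^{-C ψ_x ψ_y}` / `e^{-H^{(e)}} / e^{-H}` of Lupu 2016, Lemma 4.1 and proof of Prop. 4.2.)
[cite: Lupu2016, Lemma 4.1 and proof of Prop. 4.2] -/
theorem lintegral_comp_siteFlip (h : IsInnovationSite P X u) (hd : 0 < d)
    {F : (Site d → ℝ) → ℝ≥0∞} (hF : Measurable F) :
    ∫⁻ ω, F (siteFlip u (X · ω)) ∂P =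
      ∫⁻ ω, F (X · ω) * ENNReal.ofReal (Real.exp (-2 * X u ω * zdNeighborSum (X · ω) u)) ∂P := by
  have hd0 : (d : ℝ) ≠ 0 := by exact_mod_cast hd.ne'
  set G : (Site d → ℝ) → ℝ≥0∞ := fun φ => F φ * ENNReal.ofReal (Real.exp (-2 * φ u * zdNeighborSum φ u))
    with hG
  have hGm : Measurable G := by
    refine hF.mul (Measurable.ennreal_ofReal (Real.measurable_exp.comp ?_))
    unfold zdNeighborSum
    exact ((measurable_const.mul (measurable_pi_apply u)).mul
      (Finset.measurable_sum _ fun v _ => measurable_pi_apply v))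
  change ∫⁻ ω, (F ∘ siteFlip u) (X · ω) ∂P = ∫⁻ ω, G (X · ω) ∂P
  rw [h.lintegral_eq (hF.comp (measurable_siteFlip u)), h.lintegral_eq hGm]
  refine lintegral_congr fun y => ?_
  set c : ℝ := -(2 * ((2 * d : ℝ)⁻¹ * zdNeighborSum (extendOff u y) u)) with hc
  have hFy : Measurable fun z : ℝ => F (rebuildAt u z y) :=
    hF.comp ((measurable_rebuildAt u).comp (measurable_id.prodMk measurable_const))
  calc ∫⁻ z, (F ∘ siteFlip u) (rebuildAt u z y) ∂gaussianReal 0 (innovVar d)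
      = ∫⁻ z, F (rebuildAt u (-z + c) y) ∂gaussianReal 0 (innovVar d) := by
        simp only [Function.comp_apply, siteFlip_rebuildAt, sub_eq_add_neg, hc]
    _ = ∫⁻ z, F (rebuildAt u (z + c) y) ∂gaussianReal 0 (innovVar d) :=
        lintegral_gaussianReal_comp_neg (innovVar d) (h := fun w => F (rebuildAt u (w + c) y))
          (hFy.comp (measurable_add_const c))
    _ = ∫⁻ z, F (rebuildAt u z y) * ENNReal.ofReal
          (Real.exp ((2 * c * z - c ^ 2) / (2 * innovVar d))) ∂gaussianReal 0 (innovVar d) :=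
        lintegral_gaussianReal_comp_add_const (innovVar_ne_zero hd) hFy c
    _ = ∫⁻ z, G (rebuildAt u z y) ∂gaussianReal 0 (innovVar d) := by
        refine lintegral_congr fun z => ?_
        simp only [hG, hc, rebuildAt_apply_self, zdNeighborSum_rebuildAt, coe_innovVar]
        congr 3
        field_simp
        ring

/-- **Cameron–Martin at one site** (`d ≥ 1`): for measurable `F ≥ 0` and `t ∈ ℝ`,
`E F(X + t e_u) = E[F(X) · exp(2dt ζ_u - d t²)]`: in the innovation coordinate the shift is
`z ↦ z + t`, a translation of `N(0,1/2d)`. [folklore] -/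
theorem lintegral_comp_add_single (h : IsInnovationSite P X u) (hd : 0 < d)
    {F : (Site d → ℝ) → ℝ≥0∞} (hF : Measurable F) (t : ℝ) :
    ∫⁻ ω, F ((X · ω) + Pi.single u t) ∂P =
      ∫⁻ ω, F (X · ω) *
        ENNReal.ofReal (Real.exp (2 * d * t * siteInnovation (X · ω) u - d * t ^ 2)) ∂P := by
  have hd0 : (d : ℝ) ≠ 0 := by exact_mod_cast hd.ne'
  set G : (Site d → ℝ) → ℝ≥0∞ := fun φ => F φ *
    ENNReal.ofReal (Real.exp (2 * d * t * siteInnovation φ u - d * t ^ 2)) with hG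
  have hGm : Measurable G :=
    hF.mul (Measurable.ennreal_ofReal (Real.measurable_exp.comp
      (((measurable_const.mul (measurable_siteInnovation u)).sub measurable_const))))
  change ∫⁻ ω, (F ∘ fun φ => φ + Pi.single u t) (X · ω) ∂P = ∫⁻ ω, G (X · ω) ∂P
  rw [h.lintegral_eq (hF.comp (measurable_add_const (Pi.single u t))), h.lintegral_eq hGm]
  refine lintegral_congr fun y => ?_
  have hFy : Measurable fun z : ℝ => F (rebuildAt u z y) :=
    hF.comp ((measurable_rebuildAt u).comp (measurable_id.prodMk measurable_const))
  calc ∫⁻ z, (F ∘ fun φ => φ + Pi.single u t) (rebuildAt u z y) ∂gaussianReal 0 (innovVar d)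
      = ∫⁻ z, F (rebuildAt u (z + t) y) ∂gaussianReal 0 (innovVar d) := by
        simp only [Function.comp_apply, rebuildAt_add_single]
    _ = ∫⁻ z, F (rebuildAt u z y) * ENNReal.ofReal
          (Real.exp ((2 * t * z - t ^ 2) / (2 * innovVar d))) ∂gaussianReal 0 (innovVar d) :=
        lintegral_gaussianReal_comp_add_const (innovVar_ne_zero hd) hFy t
    _ = ∫⁻ z, G (rebuildAt u z y) ∂gaussianReal 0 (innovVar d) := by
        refine lintegral_congr fun z => ?_
        simp only [hG, siteInnovation_rebuildAt, coe_innovVar]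
        congr 3
        field_simp

end IsInnovationSite

end Literature.Probability.LatticeModels
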